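import Literature.ModelTheory.ExponentialFields.LastRootConjectureProofs
import Literature.ModelTheory.ProofTheory.GodelCoding
import HarnessLib

/-!
# The easy half of Macintyre–Wilkie's equivalence: decidability of `Th(ℝ_exp)` ⇒ Last Root Conjecture

Family `periods` (trunk T-TRANSCEND, group G06), topic `Literature/ModelTheory/ExponentialFields`,
third file on the Last Root Conjecture (`LastRootConjecture.lean`: the definition
`Literature.ModelTheory.ExponentialFields.LastRootConjecture` and the named fact
`Literature.macintyreWilkie_realExpDecidable_iff_lastRootConjecture : RealExpDecidable ↔ LastRootConjecture`,
Macintyre–Wilkie 1996 as reported by Berarducci–Servi 2004, p. 44; `LastRootConjectureProofs.lean`: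
the non-effective bound from o-minimality and the bounding sentences `σ_{F,η}`).

This file **proves the direction `→`** of that equivalence, granted Wilkie's theorem that `ℝ_exp`
is o-minimal (the named fact `Literature.ModelTheory.ExponentialFields.wilkie_isOMinimal`, periods.S28):

* `Literature.lastRootConjecture_of_realExpDecidable (hO : wilkie_isOMinimal) :
    RealExpDecidable → LastRootConjecture`.

The argument is the one indicated in the docstring of the named fact: given a decision procedure
for `Th(ℝ_exp)` and a system `F`, search for the least `η` such that the sentence `σ_{F,η}`
("every common zero of `F` at which the Jacobian has a left inverse lies in `[-η, η]ⁿ`",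
`Literature.ModelTheory.ExponentialFields.ExpPolyCode.sigma` of `LastRootConjectureProofs.lean`) is true; such an `η` exists by
o-minimality (`Literature.ModelTheory.ExponentialFields.ExpPolyCode.exists_realize_sigma`), the search is a computable function of
`F` provided the Gödel number of `σ_{F,η}` is a computable function of `(n, F, η)`, and `η + 1`
then bounds the sup norm of the non-singular zeros (`norm_lt_of_realize_sigma`). The bulk of the
file is that computability:

* `### Gödel letters`: the letters (`Literature.ModelTheory.ProofTheory.PreFOL.termLetters`, `Literature.ModelTheory.ProofTheory.PreFOL.formulaLetters` of
  `ProofTheory/GodelCoding.lean`, i.e. Mathlib's `listEncode` codes) of every term and formula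
  builder of `LastRootConjectureProofs.lean` are computed as explicit list functions
  (`natL, intL, powL, prodL, sumL, factorL, monoL, evalL` for the terms, `dnatL, dintL, dpowL,
  dprodL, dfactorL, dmonoL, devalL` for their formal partial derivatives `RealExpModel.termPDeriv`
  — computed alongside, following its defining clauses —, `eqL, leL, impL, notL, topL, infL,
  andLL` for the formulas, `zeroBL, invEntryL, invBL, boundBL, chiL, sigmaL` for the sentence),
  ending with `godelNumber_sigma : ⌜σ_{F,η}⌝ = encode (sigmaL n F η)`;
* `### primitive recursiveness`: each of these list functions is primitive recursive in the
  tuple of its arguments (Mathlib's `Primrec` combinators: `list_foldr`, `nat_iterate`,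
  `list_map`, `list_range`, `ite`, …; integers enter through their codes,
  `intL c = intLN (encode c)`), whence `computable_godelNumber_sigma`;
* `### assembly`: a computable total search (`exists_computable_search`, `Nat.rfind`), a truth
  decider extracted from `RealExpDecidable` (`exists_truth_decider`: the Gödel numbering is
  injective and `Th(ℝ_exp) ⊨ φ ↔ ℝ ⊨ φ`), and the theorem.

Consequences recorded at the end: with Macintyre–Wilkie's Thm. 1.1 (`Literature.ModelTheory.ExponentialFields.macintyre_wilkie`) and
Wilkie's o-minimality, the real Schanuel property implies the Last Root Conjecture
(`Literature.ModelTheory.ExponentialFields.lastRootConjecture_of_schanuelProperty_of_wilkie_isOMinimal`), now without the named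
equivalence.

## References

* A. Macintyre, A. J. Wilkie, *On the decidability of the real exponential field*, in:
  Kreiseliana, A K Peters (1996), 441–467.
* A. Berarducci, T. Servi, *An effective version of Wilkie's theorem of the complement and some
  effective o-minimality results*, Ann. Pure Appl. Logic 125 (2004), 43–74, p. 44.
* H. B. Enderton, *A Mathematical Introduction to Logic*, 2nd ed. (2001), §3.4 (arithmetization
  of syntax).
-/

noncomputable section

namespace Literature.ModelTheory.ExponentialFields

namespace ExpPolyCode

/-! ### Gödel letters of the bounding sentences -/

section Letters

open FirstOrder FirstOrder.Language Encodable ProofTheory.PreFOL RealExpModel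

/-- letter of the constant symbol `0` [folklore] -/
def lZero : ℕ := 2 * encode (⟨0, expRingFunc.zero⟩ : Σ i, Language.orderedExpRing.Functions i) + 1
/-- letter of the constant symbol `1` [folklore] -/
def lOne : ℕ := 2 * encode (⟨0, expRingFunc.one⟩ : Σ i, Language.orderedExpRing.Functions i) + 1
/-- letter of `+` [folklore] -/
def lAdd : ℕ := 2 * encode (⟨2, expRingFunc.add⟩ : Σ i, Language.orderedExpRing.Functions i) + 1
/-- letter of `*` [folklore] -/
def lMul : ℕ := 2 * encode (⟨2, expRingFunc.mul⟩ : Σ i, Language.orderedExpRing.Functions i) + 1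
/-- letter of `-` [folklore] -/
def lNeg : ℕ := 2 * encode (⟨1, expRingFunc.neg⟩ : Σ i, Language.orderedExpRing.Functions i) + 1
/-- letter of `exp` [folklore] -/
def lExp : ℕ := 2 * encode (⟨1, expRingFunc.exp⟩ : Σ i, Language.orderedExpRing.Functions i) + 1
/-- first letter of an atomic `≤` [folklore] -/
def lLe : ℕ := 4 * encode (⟨2, Language.leSymb⟩ : Σ i, Language.orderedExpRing.Relations i) + 1

variable {k : ℕ}

/-- The letters of the terms built by `zero`, constructor by constructor. [folklore] -/
theorem termLetters_zero' : termLetters (0 : Language.orderedExpRing.Term (Empty ⊕ Fin k)) = [lZero] := by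
  show termLetters (Term.func _ _) = _
  rw [termLetters_func]; simp [lZero]

/-- The letters of the terms built by `one`, constructor by constructor. [folklore] -/
theorem termLetters_one' : termLetters (1 : Language.orderedExpRing.Term (Empty ⊕ Fin k)) = [lOne] := by
  show termLetters (Term.func _ _) = _
  rw [termLetters_func]; simp [lOne]

/-- `l₁, l₂ ↦ lAdd :: (l₁ ++ l₂)`, the letters of a sum [folklore] -/
def addL (l₁ l₂ : List ℕ) : List ℕ := lAdd :: (l₁ ++ l₂)
/-- `l₁, l₂ ↦ lMul :: (l₁ ++ l₂)`, the letters of a product [folklore] -/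
def mulL (l₁ l₂ : List ℕ) : List ℕ := lMul :: (l₁ ++ l₂)

/-- The letters of the terms built by `add`, constructor by constructor. [folklore] -/
theorem termLetters_add' (t₁ t₂ : Language.orderedExpRing.Term (Empty ⊕ Fin k)) :
    termLetters (t₁ + t₂) = addL (termLetters t₁) (termLetters t₂) := by
  show termLetters (Term.func _ ![t₁, t₂]) = _
  rw [termLetters_func]; simp [addL, lAdd, List.ofFn_succ]

/-- The letters of the terms built by `mul`, constructor by constructor. [folklore] -/
theorem termLetters_mul' (t₁ t₂ : Language.orderedExpRing.Term (Empty ⊕ Fin k)) :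
    termLetters (t₁ * t₂) = mulL (termLetters t₁) (termLetters t₂) := by
  show termLetters (Term.func _ ![t₁, t₂]) = _
  rw [termLetters_func]; simp [mulL, lMul, List.ofFn_succ]

/-- The letters of the terms built by `neg`, constructor by constructor. [folklore] -/
theorem termLetters_neg' (t : Language.orderedExpRing.Term (Empty ⊕ Fin k)) :
    termLetters (-t) = lNeg :: termLetters t := by
  show termLetters (Term.func _ ![t]) = _
  rw [termLetters_func]; simp [lNeg, List.ofFn_succ]

/-- The letters of the terms built by `exp`, constructor by constructor. [folklore] -/
theorem termLetters_exp' (t : Language.orderedExpRing.Term (Empty ⊕ Fin k)) :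
    termLetters (Language.orderedExpRing.termExp t) = lExp :: termLetters t := by
  show termLetters (Term.func _ ![t]) = _
  rw [termLetters_func]; simp [lExp, List.ofFn_succ]

/-! #### Letters of the term builders and of their formal partial derivatives

Throughout, `D` stands for `RealExpModel.termPDeriv i` for a fixed variable `i`; the letters of
`D t` for the builders are computed alongside the letters of `t`, following the defining clauses
of `termPDeriv` (sum rule, Leibniz rule, `D (exp t) = exp t * D t`, `D 0 = D 1 = 0`). -/

/-- letters of numerals [folklore] -/
def natL : ℕ → List ℕ
  | 0 => [lZero]
  | j + 1 => addL (natL j) [lOne]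

/-- The letters of the terms built by `natTerm`, constructor by constructor. [folklore] -/
theorem termLetters_natTerm : ∀ j : ℕ,
    termLetters (natTerm j : Language.orderedExpRing.Term (Empty ⊕ Fin k)) = natL j
  | 0 => by simp [natTerm, natL, termLetters_zero']
  | j + 1 => by simp [natTerm, natL, termLetters_add', termLetters_one', termLetters_natTerm j]

/-- letters of `D` of numerals (`0 + 0 + ⋯`, unsimplified, as `termPDeriv` computes them) [folklore] -/
def dnatL : ℕ → List ℕ
  | 0 => [lZero]
  | j + 1 => addL (dnatL j) [lZero]

/-- The letters of `termPDeriv` of the terms built by `natTerm`, clause by clause. [folklore] -/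
theorem termLetters_termPDeriv_natTerm (i : Fin k) : ∀ j : ℕ,
    termLetters (termPDeriv i (natTerm j : Language.orderedExpRing.Term (Empty ⊕ Fin k))) = dnatL j
  | 0 => by simp [natTerm, dnatL, termLetters_zero']
  | j + 1 => by
    simp [natTerm, dnatL, termLetters_add', termLetters_zero', termLetters_termPDeriv_natTerm i j]

/-- letters of integer numerals [folklore] -/
def intL : ℤ → List ℕ
  | Int.ofNat j => natL j
  | Int.negSucc j => lNeg :: natL (j + 1)

/-- The letters of the terms built by `intTerm`, constructor by constructor. [folklore] -/
theorem termLetters_intTerm : ∀ c : ℤ,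
    termLetters (intTerm c : Language.orderedExpRing.Term (Empty ⊕ Fin k)) = intL c
  | Int.ofNat j => by simp [intTerm, intL, termLetters_natTerm]
  | Int.negSucc j => by simp [intTerm, intL, termLetters_neg', termLetters_natTerm]

/-- letters of `D` of integer numerals [folklore] -/
def dintL : ℤ → List ℕ
  | Int.ofNat j => dnatL j
  | Int.negSucc j => lNeg :: dnatL (j + 1)

/-- The letters of `termPDeriv` of the terms built by `intTerm`, clause by clause. [folklore] -/
theorem termLetters_termPDeriv_intTerm (i : Fin k) : ∀ c : ℤ,
    termLetters (termPDeriv i (intTerm c : Language.orderedExpRing.Term (Empty ⊕ Fin k))) = dintL c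
  | Int.ofNat j => by simp [intTerm, dintL, termLetters_termPDeriv_natTerm]
  | Int.negSucc j => by simp [intTerm, dintL, termLetters_neg', termLetters_termPDeriv_natTerm]

/-- letters of powers [folklore] -/
def powL (tl : List ℕ) : ℕ → List ℕ
  | 0 => [lOne]
  | j + 1 => mulL (powL tl j) tl

/-- The letters of the terms built by `powTerm`, constructor by constructor. [folklore] -/
theorem termLetters_powTerm (t : Language.orderedExpRing.Term (Empty ⊕ Fin k)) : ∀ j : ℕ,
    termLetters (powTerm t j) = powL (termLetters t) j
  | 0 => by simp [powTerm, powL, termLetters_one']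
  | j + 1 => by simp [powTerm, powL, termLetters_mul', termLetters_powTerm t j]

/-- letters of `D` of powers (Leibniz rule, iterated) [folklore] -/
def dpowL (tl dtl : List ℕ) : ℕ → List ℕ
  | 0 => [lZero]
  | j + 1 => addL (mulL (dpowL tl dtl j) tl) (mulL (powL tl j) dtl)

/-- The letters of `termPDeriv` of the terms built by `powTerm`, clause by clause. [folklore] -/
theorem termLetters_termPDeriv_powTerm (i : Fin k) (t : Language.orderedExpRing.Term (Empty ⊕ Fin k)) :
    ∀ j : ℕ, termLetters (termPDeriv i (powTerm t j)) = dpowL (termLetters t) (termLetters (termPDeriv i t)) j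
  | 0 => by simp [powTerm, dpowL, termLetters_zero']
  | j + 1 => by
    simp [powTerm, dpowL, termLetters_add', termLetters_mul', termLetters_powTerm,
      termLetters_termPDeriv_powTerm i t j]

/-- letters of list products [folklore] -/
def prodL : List (List ℕ) → List ℕ
  | [] => [lOne]
  | l :: ls => mulL l (prodL ls)

/-- The letters of the terms built by `prodTerm`, constructor by constructor. [folklore] -/
theorem termLetters_prodTerm : ∀ ts : List (Language.orderedExpRing.Term (Empty ⊕ Fin k)),
    termLetters (prodTerm ts) = prodL (ts.map termLetters)
  | [] => by simp [prodTerm, prodL, termLetters_one']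
  | t :: ts => by simp [prodTerm, prodL, termLetters_mul', termLetters_prodTerm ts]

/-- letters of `D` of list products, from the list of pairs (letters of a factor, letters of its
`D`) (Leibniz rule, iterated) [folklore] -/
def dprodL : List (List ℕ × List ℕ) → List ℕ
  | [] => [lZero]
  | q :: qs => addL (mulL q.2 (prodL (qs.map Prod.fst))) (mulL q.1 (dprodL qs))

/-- The letters of `termPDeriv` of the terms built by `prodTerm`, clause by clause. [folklore] -/
theorem termLetters_termPDeriv_prodTerm (i : Fin k) : ∀ ts : List (Language.orderedExpRing.Term (Empty ⊕ Fin k)),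
    termLetters (termPDeriv i (prodTerm ts)) =
      dprodL (ts.map fun t => (termLetters t, termLetters (termPDeriv i t)))
  | [] => by simp [prodTerm, dprodL, termLetters_zero']
  | t :: ts => by
    simp [prodTerm, dprodL, termLetters_add', termLetters_mul', termLetters_prodTerm,
      termLetters_termPDeriv_prodTerm i ts, List.map_map, Function.comp_def]

/-- letters of list sums [folklore] -/
def sumL : List (List ℕ) → List ℕ
  | [] => [lZero]
  | l :: ls => addL l (sumL ls)

/-- The letters of the terms built by `sumTerm`, constructor by constructor. [folklore] -/
theorem termLetters_sumTerm : ∀ ts : List (Language.orderedExpRing.Term (Empty ⊕ Fin k)),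
    termLetters (sumTerm ts) = sumL (ts.map termLetters)
  | [] => by simp [sumTerm, sumL, termLetters_zero']
  | t :: ts => by simp [sumTerm, sumL, termLetters_add', termLetters_sumTerm ts]

/-- letters of the monomial factor `factorTerm a b t` [folklore] -/
def factorL (a b : ℕ) (tl : List ℕ) : List ℕ := mulL (powL tl a) (powL (lExp :: tl) b)

/-- The letters of the terms built by `factorTerm`, constructor by constructor. [folklore] -/
theorem termLetters_factorTerm (a b : ℕ) (t : Language.orderedExpRing.Term (Empty ⊕ Fin k)) :
    termLetters (factorTerm a b t) = factorL a b (termLetters t) := by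
  simp [factorTerm, factorL, termLetters_mul', termLetters_powTerm, termLetters_exp']

/-- letters of `D` of the monomial factor, from the letters of `t` and of `D t` [folklore] -/
def dfactorL (a b : ℕ) (tl dtl : List ℕ) : List ℕ :=
  addL (mulL (dpowL tl dtl a) (powL (lExp :: tl) b))
    (mulL (powL tl a) (dpowL (lExp :: tl) (mulL (lExp :: tl) dtl) b))

/-- The letters of `termPDeriv` of the terms built by `factorTerm`, clause by clause. [folklore] -/
theorem termLetters_termPDeriv_factorTerm (i : Fin k) (a b : ℕ) (t : Language.orderedExpRing.Term (Empty ⊕ Fin k)) :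
    termLetters (termPDeriv i (factorTerm a b t)) = dfactorL a b (termLetters t) (termLetters (termPDeriv i t)) := by
  simp [factorTerm, dfactorL, termLetters_add', termLetters_mul', termLetters_powTerm, termLetters_exp',
    termLetters_termPDeriv_powTerm]

/-- Mapping over `List.finRange n` through `Fin.val` is mapping over `List.range n`. [folklore] -/
theorem map_finRange_val {β : Type*} (n : ℕ) (f : ℕ → β) :
    ((List.finRange n).map fun i : Fin n => f i.val) = (List.range n).map f := by
  apply List.ext_getElem
  · simp
  · intro i h₁ h₂
    simp

variable (n : ℕ)

/-- letters of the term of a monomial at variable letters `xsL` [folklore] -/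
def monoL (xsL : ℕ → List ℕ) (m : ℤ × List ℕ) : List ℕ :=
  mulL (intL m.1) (prodL ((List.range n).map fun i => factorL (m.2.getD i 0) (m.2.getD (n + i) 0) (xsL i)))

/-- The letters of the terms built by `monoTermX`, constructor by constructor. [folklore] -/
theorem termLetters_monoTermX (xs : Fin n → Language.orderedExpRing.Term (Empty ⊕ Fin k))
    (xsL : ℕ → List ℕ) (hxs : ∀ i : Fin n, termLetters (xs i) = xsL i) (m : ℤ × List ℕ) :
    termLetters (monoTermX n xs m) = monoL n xsL m := by
  simp only [monoTermX, monoL, termLetters_mul', termLetters_intTerm, termLetters_prodTerm,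
    List.map_map, Function.comp_def, termLetters_factorTerm, hxs]
  rw [← map_finRange_val n fun i => factorL (m.2.getD i 0) (m.2.getD (n + i) 0) (xsL i)]

/-- letters of `D` of the term of a monomial, from the letters `xsL` of the variables and `dxsL` of
their `D`s [folklore] -/
def dmonoL (xsL dxsL : ℕ → List ℕ) (m : ℤ × List ℕ) : List ℕ :=
  addL (mulL (dintL m.1) (prodL ((List.range n).map fun i =>
      factorL (m.2.getD i 0) (m.2.getD (n + i) 0) (xsL i))))
    (mulL (intL m.1) (dprodL ((List.range n).map fun i =>
      (factorL (m.2.getD i 0) (m.2.getD (n + i) 0) (xsL i),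
        dfactorL (m.2.getD i 0) (m.2.getD (n + i) 0) (xsL i) (dxsL i)))))

/-- The letters of `termPDeriv` of the terms built by `monoTermX`, clause by clause. [folklore] -/
theorem termLetters_termPDeriv_monoTermX (i : Fin k) (xs : Fin n → Language.orderedExpRing.Term (Empty ⊕ Fin k))
    (xsL dxsL : ℕ → List ℕ) (hxs : ∀ j : Fin n, termLetters (xs j) = xsL j)
    (hdxs : ∀ j : Fin n, termLetters (termPDeriv i (xs j)) = dxsL j) (m : ℤ × List ℕ) :
    termLetters (termPDeriv i (monoTermX n xs m)) = dmonoL n xsL dxsL m := by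
  simp only [monoTermX, termPDeriv_mul, termLetters_add', termLetters_mul', termLetters_intTerm,
    termLetters_termPDeriv_intTerm, termLetters_prodTerm, termLetters_termPDeriv_prodTerm, List.map_map,
    Function.comp_def, termLetters_factorTerm, termLetters_termPDeriv_factorTerm, hxs, hdxs, dmonoL]
  rw [← map_finRange_val n fun j => factorL (m.2.getD j 0) (m.2.getD (n + j) 0) (xsL j),
    ← map_finRange_val n fun j => (factorL (m.2.getD j 0) (m.2.getD (n + j) 0) (xsL j),
      dfactorL (m.2.getD j 0) (m.2.getD (n + j) 0) (xsL j) (dxsL j))]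

/-- letters of the term of a code [folklore] -/
def evalL (xsL : ℕ → List ℕ) : ExpPolyCode → List ℕ
  | [] => [lZero]
  | m :: p => addL (monoL n xsL m) (evalL xsL p)

/-- The letters of the terms built by `evalTermX`, constructor by constructor. [folklore] -/
theorem termLetters_evalTermX (xs : Fin n → Language.orderedExpRing.Term (Empty ⊕ Fin k))
    (xsL : ℕ → List ℕ) (hxs : ∀ i : Fin n, termLetters (xs i) = xsL i) :
    ∀ p : ExpPolyCode, termLetters (evalTermX n xs p) = evalL n xsL p
  | [] => by simp [evalTermX, evalL, termLetters_zero']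
  | m :: p => by
    simp [evalTermX, evalL, termLetters_add', termLetters_monoTermX n xs xsL hxs,
      termLetters_evalTermX xs xsL hxs p]

/-- letters of `D` of the term of a code [folklore] -/
def devalL (xsL dxsL : ℕ → List ℕ) : ExpPolyCode → List ℕ
  | [] => [lZero]
  | m :: p => addL (dmonoL n xsL dxsL m) (devalL xsL dxsL p)

/-- The letters of `termPDeriv` of the terms built by `evalTermX`, clause by clause. [folklore] -/
theorem termLetters_termPDeriv_evalTermX (i : Fin k) (xs : Fin n → Language.orderedExpRing.Term (Empty ⊕ Fin k))
    (xsL dxsL : ℕ → List ℕ) (hxs : ∀ j : Fin n, termLetters (xs j) = xsL j)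
    (hdxs : ∀ j : Fin n, termLetters (termPDeriv i (xs j)) = dxsL j) :
    ∀ p : ExpPolyCode, termLetters (termPDeriv i (evalTermX n xs p)) = devalL n xsL dxsL p
  | [] => by simp [evalTermX, devalL, termLetters_zero']
  | m :: p => by
    simp [evalTermX, devalL, termLetters_add', termLetters_termPDeriv_monoTermX n i xs xsL dxsL hxs hdxs,
      termLetters_termPDeriv_evalTermX i xs xsL dxsL hxs hdxs p]

/-! #### Formula letters at depth `k` -/

/-- letters of an equation between terms with letters `l₁`, `l₂` [folklore] -/
def eqL (k : ℕ) (l₁ l₂ : List ℕ) : List ℕ := [2 * Nat.pair k (encode l₁), 2 * Nat.pair k (encode l₂)]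

/-- The letters of the formulas built by `bdEqual`, constructor by constructor. [folklore] -/
theorem formulaLetters_bdEqual (t₁ t₂ : Language.orderedExpRing.Term (Empty ⊕ Fin k)) :
    formulaLetters (Term.bdEqual t₁ t₂) = eqL k (termLetters t₁) (termLetters t₂) := by
  show formulaLetters (BoundedFormula.equal t₁ t₂) = _
  rw [formulaLetters_equal, encode_term_eq, encode_term_eq]; rfl

/-- letters of `t₁ ≤ t₂` [folklore] -/
def leL (k : ℕ) (l₁ l₂ : List ℕ) : List ℕ :=
  lLe :: (4 * k + 3) :: [2 * Nat.pair k (encode l₁), 2 * Nat.pair k (encode l₂)]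

/-- The letters of the formulas built by `le`, constructor by constructor. [folklore] -/
theorem formulaLetters_le (t₁ t₂ : Language.orderedExpRing.Term (Empty ⊕ Fin k)) :
    formulaLetters (t₁.le t₂) = leL k (termLetters t₁) (termLetters t₂) := by
  show formulaLetters (BoundedFormula.rel _ ![t₁, t₂]) = _
  rw [formulaLetters_rel]
  simp [leL, lLe, List.ofFn_succ, encode_term_eq]

/-- letters of `⊥` [folklore] -/
def falsumL (k : ℕ) : List ℕ := [4 * k + 11]
/-- letters of an implication [folklore] -/
def impL (l₁ l₂ : List ℕ) : List ℕ := 3 :: (l₁ ++ l₂)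
/-- letters of a negation [folklore] -/
def notL (k : ℕ) (l : List ℕ) : List ℕ := impL l (falsumL k)
/-- letters of `⊤` [folklore] -/
def topL (k : ℕ) : List ℕ := notL k (falsumL k)
/-- letters of a conjunction [folklore] -/
def infL (k : ℕ) (l₁ l₂ : List ℕ) : List ℕ := notL k (impL l₁ (notL k l₂))

/-- The letters of the formulas built by `imp`, constructor by constructor. [folklore] -/
theorem formulaLetters_imp' (φ ψ : Language.orderedExpRing.BoundedFormula Empty k) :
    formulaLetters (φ ⟹ ψ) = impL (formulaLetters φ) (formulaLetters ψ) := formulaLetters_imp φ ψ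

/-- The letters of the formulas built by `not`, constructor by constructor. [folklore] -/
theorem formulaLetters_not' (φ : Language.orderedExpRing.BoundedFormula Empty k) :
    formulaLetters φ.not = notL k (formulaLetters φ) := by
  show formulaLetters (φ.imp BoundedFormula.falsum) = _
  rw [formulaLetters_imp, formulaLetters_falsum]; rfl

/-- The letters of the formulas built by `top`, constructor by constructor. [folklore] -/
theorem formulaLetters_top' : formulaLetters (⊤ : Language.orderedExpRing.BoundedFormula Empty k) = topL k := by
  show formulaLetters (BoundedFormula.not BoundedFormula.falsum) = _
  rw [formulaLetters_not', formulaLetters_falsum]; rfl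

/-- The letters of the formulas built by `inf`, constructor by constructor. [folklore] -/
theorem formulaLetters_inf' (φ ψ : Language.orderedExpRing.BoundedFormula Empty k) :
    formulaLetters (φ ⊓ ψ) = infL k (formulaLetters φ) (formulaLetters ψ) := by
  show formulaLetters ((φ.imp ψ.not).not) = _
  rw [formulaLetters_not', formulaLetters_imp, formulaLetters_not']; rfl

/-- letters of `andL` [folklore] -/
def andLL (k : ℕ) : List (List ℕ) → List ℕ
  | [] => topL k
  | l :: ls => infL k l (andLL k ls)

/-- The letters of the formulas built by `andL`, constructor by constructor. [folklore] -/
theorem formulaLetters_andL : ∀ φs : List (Language.orderedExpRing.BoundedFormula Empty k),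
    formulaLetters (andL φs) = andLL k (φs.map formulaLetters)
  | [] => by simp [andL, andLL, formulaLetters_top']
  | φ :: φs => by simp [andL, andLL, formulaLetters_inf', formulaLetters_andL φs]

/-- The letters of the formulas built by `alls`, constructor by constructor. [folklore] -/
theorem formulaLetters_alls : ∀ {k : ℕ} (φ : Language.orderedExpRing.BoundedFormula Empty k),
    formulaLetters φ.alls = List.replicate k 7 ++ formulaLetters φ
  | 0, φ => rfl
  | k + 1, φ => by
    rw [show φ.alls = φ.all.alls from rfl, formulaLetters_alls φ.all, formulaLetters_all,
      List.replicate_succ']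
    simp

/-! #### Letters of `σ_{F,η}` -/

/-- letters of the coordinate variable `x_i` [folklore] -/
def xvL (i : ℕ) : List ℕ := [4 * i + 2]
/-- letters of `D_k x_i` (`1` or `0`) [folklore] -/
def dxvL (i kk : ℕ) : List ℕ := if i = kk then [lOne] else [lZero]
/-- letters of the matrix variable `B i j` (index `n + (j + n·i)`, Mathlib's `finProdFinEquiv`) [folklore] -/
def bvL (i j : ℕ) : List ℕ := [4 * (n + (j + n * i)) + 2]

/-- The letters of the terms built by `xv`, constructor by constructor. [folklore] -/
theorem termLetters_xv (i : Fin n) : termLetters (xv n i) = xvL i.val := by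
  rw [xv, termLetters_var]; rfl

/-- The letters of `termPDeriv` of the terms built by `xv`, clause by clause. [folklore] -/
theorem termLetters_termPDeriv_xv (kk i : Fin n) :
    termLetters (termPDeriv (Fin.castAdd (n * n) kk) (xv n i)) = dxvL i.val kk.val := by
  unfold xv dxvL
  by_cases h : i = kk
  · subst h
    rw [termPDeriv_var_inr_self, if_pos rfl, termLetters_one']
  · have h' : Fin.castAdd (n * n) i ≠ Fin.castAdd (n * n) kk := fun e => h (Fin.castAdd_injective _ _ e)
    have h'' : i.val ≠ kk.val := fun e => h (Fin.ext e)
    rw [termPDeriv_var_inr_of_ne _ _ h', if_neg h'', termLetters_zero']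

/-- The letters of the terms built by `bv`, constructor by constructor. [folklore] -/
theorem termLetters_bv (i j : Fin n) : termLetters (bv n i j) = bvL n i.val j.val := by
  rw [bv, termLetters_var]
  simp [bvL]

variable (F : List ExpPolyCode) (η : ℕ)

/-- letters of `zeroB` [folklore] -/
def zeroBL : List ℕ :=
  andLL (n + n * n) ((List.range n).map fun i => eqL (n + n * n) (evalL n xvL (F.getD i [])) [lZero])

/-- The letters of the formulas built by `zeroB`, constructor by constructor. [folklore] -/
theorem formulaLetters_zeroB : formulaLetters (zeroB n F) = zeroBL n F := by
  rw [zeroB, formulaLetters_andL, zeroBL, List.map_map]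
  congr 1
  rw [← map_finRange_val n (fun i => eqL (n + n * n) (evalL n xvL (F.getD i [])) [lZero])]
  refine List.map_congr_left fun i _ => ?_
  simp [rowTermB, formulaLetters_bdEqual, termLetters_evalTermX n (xv n) xvL (termLetters_xv n), termLetters_zero']

/-- letters of `invEntryB i kk` [folklore] -/
def invEntryL (i kk : ℕ) : List ℕ :=
  eqL (n + n * n)
    (sumL ((List.range n).map fun j => mulL (bvL n i j) (devalL n xvL (fun i' => dxvL i' kk) (F.getD j []))))
    (if i = kk then [lOne] else [lZero])

/-- The letters of the formulas built by `invEntryB`, constructor by constructor. [folklore] -/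
theorem formulaLetters_invEntryB (i kk : Fin n) :
    formulaLetters (invEntryB n F i kk) = invEntryL n F i.val kk.val := by
  rw [invEntryB, formulaLetters_bdEqual, invEntryL, termLetters_sumTerm, List.map_map]
  congr 2
  · rw [← map_finRange_val n fun j => mulL (bvL n i.val j) (devalL n xvL (fun i' => dxvL i' kk.val) (F.getD j []))]
    refine List.map_congr_left fun j _ => ?_
    simp [rowTermB, termLetters_mul', termLetters_bv,
      termLetters_termPDeriv_evalTermX n (Fin.castAdd (n * n) kk) (xv n) xvL (fun i' => dxvL i' kk.val)
        (termLetters_xv n) (fun j' => termLetters_termPDeriv_xv n kk j')]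
  · by_cases h : i = kk
    · subst h; simp [termLetters_one']
    · have h' : i.val ≠ kk.val := fun e => h (Fin.ext e)
      simp [h, h', termLetters_zero']

/-- letters of `invB` [folklore] -/
def invBL : List ℕ :=
  andLL (n + n * n) ((List.range n).map fun i => andLL (n + n * n) ((List.range n).map fun kk => invEntryL n F i kk))

/-- The letters of the formulas built by `invB`, constructor by constructor. [folklore] -/
theorem formulaLetters_invB : formulaLetters (invB n F) = invBL n F := by
  rw [invB, formulaLetters_andL, invBL, List.map_map]
  congr 1
  rw [← map_finRange_val n fun i => andLL (n + n * n) ((List.range n).map fun kk => invEntryL n F i kk)]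
  refine List.map_congr_left fun i _ => ?_
  simp only [Function.comp_def, formulaLetters_andL, List.map_map]
  congr 1
  rw [← map_finRange_val n fun kk => invEntryL n F i.val kk]
  refine List.map_congr_left fun kk _ => ?_
  simp [formulaLetters_invEntryB]

/-- letters of `boundB` [folklore] -/
def boundBL : List ℕ :=
  andLL (n + n * n) ((List.range n).map fun i =>
    infL (n + n * n) (leL (n + n * n) (lNeg :: natL η) (xvL i)) (leL (n + n * n) (xvL i) (natL η)))

/-- The letters of the formulas built by `boundB`, constructor by constructor. [folklore] -/
theorem formulaLetters_boundB : formulaLetters (boundB n η) = boundBL n η := by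
  rw [boundB, formulaLetters_andL, boundBL, List.map_map]
  congr 1
  rw [← map_finRange_val n fun i =>
    infL (n + n * n) (leL (n + n * n) (lNeg :: natL η) (xvL i)) (leL (n + n * n) (xvL i) (natL η))]
  refine List.map_congr_left fun i _ => ?_
  simp [formulaLetters_inf', formulaLetters_le, termLetters_neg', termLetters_natTerm, termLetters_xv]

/-- letters of `χ` [folklore] -/
def chiL : List ℕ := impL (infL (n + n * n) (zeroBL n F) (invBL n F)) (boundBL n η)

/-- The letters of the formulas built by `chi`, constructor by constructor. [folklore] -/
theorem formulaLetters_chi : formulaLetters (chi n F η) = chiL n F η := by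
  rw [chi, nonsingB, formulaLetters_imp', formulaLetters_inf', formulaLetters_zeroB, formulaLetters_invB,
    formulaLetters_boundB]; rfl

/-- **letters of `σ_{F,η}`** [folklore] -/
def sigmaL : List ℕ := List.replicate (n + n * n) 7 ++ chiL n F η

/-- The letters of the formulas built by `sigma`, constructor by constructor. [folklore] -/
theorem formulaLetters_sigma : formulaLetters (sigma n F η) = sigmaL n F η := by
  rw [sigma, formulaLetters_alls, formulaLetters_chi]; rfl

/-- **the Gödel number of `σ_{F,η}`** is the code of its letters [folklore] -/
theorem godelNumber_sigma : (sigma n F η).godelNumber = encode (sigmaL n F η) := by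
  rw [godelNumber_eq, formulaLetters_sigma]

end Letters

/-! ### The letters of `σ_{F,η}` are a primitive recursive function of `(n, F, η)` -/

section PrimrecLetters

open Encodable

/-- `addL` is primitive recursive (in the indicated tupling of its arguments). [folklore] -/
theorem primrec_addL : Primrec₂ addL :=
  (Primrec.list_cons.comp (Primrec.const _) (Primrec.list_append.comp Primrec.fst Primrec.snd)).to₂

/-- `mulL` is primitive recursive (in the indicated tupling of its arguments). [folklore] -/
theorem primrec_mulL : Primrec₂ mulL :=
  (Primrec.list_cons.comp (Primrec.const _) (Primrec.list_append.comp Primrec.fst Primrec.snd)).to₂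

/-- `natL` as an iteration (for the primitive recursion). [folklore] -/
theorem natL_eq_iterate (j : ℕ) : natL j = (fun acc => addL acc [lOne])^[j] [lZero] := by
  induction j with
  | zero => rfl
  | succ j ih => rw [Function.iterate_succ_apply', ← ih]; rfl

/-- `natL` is primitive recursive (in the indicated tupling of its arguments). [folklore] -/
theorem primrec_natL : Primrec natL :=
  (Primrec.nat_iterate Primrec.id (Primrec.const _)
    (primrec_addL.comp Primrec.snd (Primrec.const _)).to₂).of_eq fun j => (natL_eq_iterate j).symm

/-- `dnatL` as an iteration (for the primitive recursion). [folklore] -/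
theorem dnatL_eq_iterate (j : ℕ) : dnatL j = (fun acc => addL acc [lZero])^[j] [lZero] := by
  induction j with
  | zero => rfl
  | succ j ih => rw [Function.iterate_succ_apply', ← ih]; rfl

/-- `dnatL` is primitive recursive (in the indicated tupling of its arguments). [folklore] -/
theorem primrec_dnatL : Primrec dnatL :=
  (Primrec.nat_iterate Primrec.id (Primrec.const _)
    (primrec_addL.comp Primrec.snd (Primrec.const _)).to₂).of_eq fun j => (dnatL_eq_iterate j).symm

/-- Mathlib's code of a non-negative integer `j` is `2 j` (zigzag coding `Equiv.intEquivNat`). [folklore] -/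
theorem encode_int_ofNat (j : ℕ) : encode (Int.ofNat j) = 2 * j := by
  show Nat.bit false j = 2 * j
  exact congrFun Nat.bit_false j

/-- Mathlib's code of the negative integer `-(j+1)` is `2 j + 1`. [folklore] -/
theorem encode_int_negSucc (j : ℕ) : encode (Int.negSucc j) = 2 * j + 1 := by
  show Nat.bit true j = 2 * j + 1
  exact congrFun Nat.bit_true j

/-- `intL` through the code of the integer [folklore] -/
def intLN (m : ℕ) : List ℕ := if m % 2 = 0 then natL (m / 2) else lNeg :: natL (m / 2 + 1)

/-- `dintL` through the code of the integer [folklore] -/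
def dintLN (m : ℕ) : List ℕ := if m % 2 = 0 then dnatL (m / 2) else lNeg :: dnatL (m / 2 + 1)

/-- `intL` through the code of the integer. [folklore] -/
theorem intL_eq (c : ℤ) : intL c = intLN (encode c) := by
  cases c with
  | ofNat j =>
    rw [encode_int_ofNat]
    have h1 : (2 * j) % 2 = 0 := by omega
    have h2 : (2 * j) / 2 = j := by omega
    simp [intL, intLN, h1, h2]
  | negSucc j =>
    rw [encode_int_negSucc]
    have h1 : (2 * j + 1) % 2 = 1 := by omega
    have h2 : (2 * j + 1) / 2 = j := by omega
    simp [intL, intLN, h1, h2]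

/-- `dintL` through the code of the integer. [folklore] -/
theorem dintL_eq (c : ℤ) : dintL c = dintLN (encode c) := by
  cases c with
  | ofNat j =>
    rw [encode_int_ofNat]
    have h1 : (2 * j) % 2 = 0 := by omega
    have h2 : (2 * j) / 2 = j := by omega
    simp [dintL, dintLN, h1, h2]
  | negSucc j =>
    rw [encode_int_negSucc]
    have h1 : (2 * j + 1) % 2 = 1 := by omega
    have h2 : (2 * j + 1) / 2 = j := by omega
    simp [dintL, dintLN, h1, h2]

/-- `intLN` is primitive recursive (in the indicated tupling of its arguments). [folklore] -/
theorem primrec_intLN : Primrec intLN := by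
  unfold intLN
  refine Primrec.ite (PrimrecRel.comp Primrec.eq (Primrec.nat_mod.comp Primrec.id (Primrec.const 2))
    (Primrec.const 0)) (primrec_natL.comp (Primrec.nat_div.comp Primrec.id (Primrec.const 2))) ?_
  exact Primrec.list_cons.comp (Primrec.const _)
    (primrec_natL.comp (Primrec.succ.comp (Primrec.nat_div.comp Primrec.id (Primrec.const 2))))

/-- `dintLN` is primitive recursive (in the indicated tupling of its arguments). [folklore] -/
theorem primrec_dintLN : Primrec dintLN := by
  unfold dintLN
  refine Primrec.ite (PrimrecRel.comp Primrec.eq (Primrec.nat_mod.comp Primrec.id (Primrec.const 2))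
    (Primrec.const 0)) (primrec_dnatL.comp (Primrec.nat_div.comp Primrec.id (Primrec.const 2))) ?_
  exact Primrec.list_cons.comp (Primrec.const _)
    (primrec_dnatL.comp (Primrec.succ.comp (Primrec.nat_div.comp Primrec.id (Primrec.const 2))))

/-- `intL` is primitive recursive (in the indicated tupling of its arguments). [folklore] -/
theorem primrec_intL : Primrec intL :=
  (primrec_intLN.comp Primrec.encode).of_eq fun c => (intL_eq c).symm

/-- `dintL` is primitive recursive (in the indicated tupling of its arguments). [folklore] -/
theorem primrec_dintL : Primrec dintL :=
  (primrec_dintLN.comp Primrec.encode).of_eq fun c => (dintL_eq c).symm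

/-- the pair `(powL tl j, dpowL tl dtl j)` as an iteration [folklore] -/
theorem powL_dpowL_eq_iterate (tl dtl : List ℕ) (j : ℕ) :
    (powL tl j, dpowL tl dtl j) =
      (fun q : List ℕ × List ℕ => (mulL q.1 tl, addL (mulL q.2 tl) (mulL q.1 dtl)))^[j] ([lOne], [lZero]) := by
  induction j with
  | zero => rfl
  | succ j ih => rw [Function.iterate_succ_apply', ← ih]; rfl

/-- `(tl, dtl, j) ↦ (powL tl j, dpowL tl dtl j)` is primitive recursive [folklore] -/
theorem primrec_powL_dpowL : Primrec fun p : List ℕ × List ℕ × ℕ => (powL p.1 p.2.2, dpowL p.1 p.2.1 p.2.2) := by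
  have h : Primrec fun p : List ℕ × List ℕ × ℕ =>
      (fun q : List ℕ × List ℕ => (mulL q.1 p.1, addL (mulL q.2 p.1) (mulL q.1 p.2.1)))^[p.2.2] ([lOne], [lZero]) := by
    refine Primrec.nat_iterate (Primrec.snd.comp Primrec.snd) (Primrec.const _) ?_
    have hs : Primrec fun r : (List ℕ × List ℕ × ℕ) × (List ℕ × List ℕ) =>
        (mulL r.2.1 r.1.1, addL (mulL r.2.2 r.1.1) (mulL r.2.1 r.1.2.1)) :=
      Primrec.pair (primrec_mulL.comp (Primrec.fst.comp Primrec.snd) (Primrec.fst.comp Primrec.fst))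
        (primrec_addL.comp
          (primrec_mulL.comp (Primrec.snd.comp Primrec.snd) (Primrec.fst.comp Primrec.fst))
          (primrec_mulL.comp (Primrec.fst.comp Primrec.snd) (Primrec.fst.comp (Primrec.snd.comp Primrec.fst))))
    exact hs.to₂
  exact h.of_eq fun p => (powL_dpowL_eq_iterate p.1 p.2.1 p.2.2).symm

/-- `powL` is primitive recursive (in the indicated tupling of its arguments). [folklore] -/
theorem primrec_powL : Primrec₂ powL := by
  have h : Primrec fun p : List ℕ × ℕ => (powL p.1 p.2, dpowL p.1 [] p.2).1 :=
    Primrec.fst.comp (primrec_powL_dpowL.comp (Primrec.pair Primrec.fst (Primrec.pair (Primrec.const []) Primrec.snd)))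
  exact h.to₂

/-- `dpowL` on triples `(tl, dtl, j)` [folklore] -/
theorem primrec_dpowL : Primrec fun p : List ℕ × List ℕ × ℕ => dpowL p.1 p.2.1 p.2.2 :=
  Primrec.snd.comp primrec_powL_dpowL

/-- `prodL` as a right fold (for the primitive recursion). [folklore] -/
theorem prodL_eq_foldr (ls : List (List ℕ)) : prodL ls = ls.foldr mulL [lOne] := by
  induction ls with
  | nil => rfl
  | cons l ls ih => simp [prodL, ih]

/-- `prodL` is primitive recursive (in the indicated tupling of its arguments). [folklore] -/
theorem primrec_prodL : Primrec prodL :=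
  (Primrec.list_foldr Primrec.id (Primrec.const _)
    (primrec_mulL.comp (Primrec.fst.comp Primrec.snd) (Primrec.snd.comp Primrec.snd)).to₂).of_eq
    fun ls => (prodL_eq_foldr ls).symm

/-- `sumL` as a right fold (for the primitive recursion). [folklore] -/
theorem sumL_eq_foldr (ls : List (List ℕ)) : sumL ls = ls.foldr addL [lZero] := by
  induction ls with
  | nil => rfl
  | cons l ls ih => simp [sumL, ih]

/-- `sumL` is primitive recursive (in the indicated tupling of its arguments). [folklore] -/
theorem primrec_sumL : Primrec sumL :=
  (Primrec.list_foldr Primrec.id (Primrec.const _)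
    (primrec_addL.comp (Primrec.fst.comp Primrec.snd) (Primrec.snd.comp Primrec.snd)).to₂).of_eq
    fun ls => (sumL_eq_foldr ls).symm

/-- the pair `(prodL (qs.map fst), dprodL qs)` as a right fold [folklore] -/
theorem prodL_dprodL_eq_foldr (qs : List (List ℕ × List ℕ)) :
    (prodL (qs.map Prod.fst), dprodL qs) =
      qs.foldr (fun q r => (mulL q.1 r.1, addL (mulL q.2 r.1) (mulL q.1 r.2))) ([lOne], [lZero]) := by
  induction qs with
  | nil => rfl
  | cons q qs ih => simp [prodL, dprodL, ← ih]

/-- `dprodL` is primitive recursive (in the indicated tupling of its arguments). [folklore] -/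
theorem primrec_dprodL : Primrec dprodL := by
  have h : Primrec fun qs : List (List ℕ × List ℕ) =>
      qs.foldr (fun q r => (mulL q.1 r.1, addL (mulL q.2 r.1) (mulL q.1 r.2))) ([lOne], [lZero]) := by
    refine Primrec.list_foldr (h := fun (_ : List (List ℕ × List ℕ)) (qr : (List ℕ × List ℕ) × (List ℕ × List ℕ)) =>
      (mulL qr.1.1 qr.2.1, addL (mulL qr.1.2 qr.2.1) (mulL qr.1.1 qr.2.2))) Primrec.id (Primrec.const _) ?_
    have hs : Primrec fun r : List (List ℕ × List ℕ) × ((List ℕ × List ℕ) × (List ℕ × List ℕ)) =>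
        (mulL r.2.1.1 r.2.2.1, addL (mulL r.2.1.2 r.2.2.1) (mulL r.2.1.1 r.2.2.2)) := by
      have q1 : Primrec fun r : List (List ℕ × List ℕ) × ((List ℕ × List ℕ) × (List ℕ × List ℕ)) => r.2.1.1 :=
        Primrec.fst.comp (Primrec.fst.comp Primrec.snd)
      have q2 : Primrec fun r : List (List ℕ × List ℕ) × ((List ℕ × List ℕ) × (List ℕ × List ℕ)) => r.2.1.2 :=
        Primrec.snd.comp (Primrec.fst.comp Primrec.snd)
      have r1 : Primrec fun r : List (List ℕ × List ℕ) × ((List ℕ × List ℕ) × (List ℕ × List ℕ)) => r.2.2.1 :=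
        Primrec.fst.comp (Primrec.snd.comp Primrec.snd)
      have r2 : Primrec fun r : List (List ℕ × List ℕ) × ((List ℕ × List ℕ) × (List ℕ × List ℕ)) => r.2.2.2 :=
        Primrec.snd.comp (Primrec.snd.comp Primrec.snd)
      exact Primrec.pair (primrec_mulL.comp q1 r1)
        (primrec_addL.comp (primrec_mulL.comp q2 r1) (primrec_mulL.comp q1 r2))
    exact hs.to₂
  exact (Primrec.snd.comp h).of_eq fun qs => by rw [← prodL_dprodL_eq_foldr]

/-- `factorL` on triples `(a, b, tl)` [folklore] -/
theorem primrec_factorL : Primrec fun p : ℕ × ℕ × List ℕ => factorL p.1 p.2.1 p.2.2 := by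
  unfold factorL
  exact primrec_mulL.comp (primrec_powL.comp (Primrec.snd.comp Primrec.snd) Primrec.fst)
    (primrec_powL.comp (Primrec.list_cons.comp (Primrec.const _) (Primrec.snd.comp Primrec.snd))
      (Primrec.fst.comp Primrec.snd))

/-- `dfactorL` on quadruples `(a, b, tl, dtl)` [folklore] -/
theorem primrec_dfactorL : Primrec fun p : ℕ × ℕ × List ℕ × List ℕ => dfactorL p.1 p.2.1 p.2.2.1 p.2.2.2 := by
  unfold dfactorL
  have ha : Primrec fun p : ℕ × ℕ × List ℕ × List ℕ => p.1 := Primrec.fst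
  have hb : Primrec fun p : ℕ × ℕ × List ℕ × List ℕ => p.2.1 := Primrec.fst.comp Primrec.snd
  have ht : Primrec fun p : ℕ × ℕ × List ℕ × List ℕ => p.2.2.1 := Primrec.fst.comp (Primrec.snd.comp Primrec.snd)
  have hd : Primrec fun p : ℕ × ℕ × List ℕ × List ℕ => p.2.2.2 := Primrec.snd.comp (Primrec.snd.comp Primrec.snd)
  have he : Primrec fun p : ℕ × ℕ × List ℕ × List ℕ => lExp :: p.2.2.1 := Primrec.list_cons.comp (Primrec.const _) ht
  refine primrec_addL.comp ?_ ?_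
  · exact primrec_mulL.comp (primrec_dpowL.comp (Primrec.pair ht (Primrec.pair hd ha)))
      (primrec_powL.comp he hb)
  · exact primrec_mulL.comp (primrec_powL.comp ht ha)
      (primrec_dpowL.comp (Primrec.pair he (Primrec.pair (primrec_mulL.comp he hd) hb)))

/-- `xvL` is primitive recursive (in the indicated tupling of its arguments). [folklore] -/
theorem primrec_xvL : Primrec xvL :=
  Primrec.list_cons.comp (Primrec.nat_add.comp (Primrec.nat_mul.comp (Primrec.const 4) Primrec.id)
    (Primrec.const 2)) (Primrec.const [])

/-- `dxvL` is primitive recursive (in the indicated tupling of its arguments). [folklore] -/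
theorem primrec_dxvL : Primrec₂ dxvL :=
  (Primrec.ite (PrimrecRel.comp Primrec.eq Primrec.fst Primrec.snd) (Primrec.const _) (Primrec.const _)).to₂

/-- `bvL` on triples `(n, i, j)` [folklore] -/
theorem primrec_bvL : Primrec fun p : ℕ × ℕ × ℕ => bvL p.1 p.2.1 p.2.2 := by
  unfold bvL
  refine Primrec.list_cons.comp ?_ (Primrec.const [])
  refine Primrec.nat_add.comp (Primrec.nat_mul.comp (Primrec.const 4) ?_) (Primrec.const 2)
  exact Primrec.nat_add.comp Primrec.fst (Primrec.nat_add.comp (Primrec.snd.comp Primrec.snd)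
    (Primrec.nat_mul.comp Primrec.fst (Primrec.fst.comp Primrec.snd)))

/-- the factor letters of a monomial as a function of `((n, m), i)` [folklore] -/
theorem primrec_factorArgs : Primrec fun q : (ℕ × (ℤ × List ℕ)) × ℕ =>
    factorL (q.1.2.2.getD q.2 0) (q.1.2.2.getD (q.1.1 + q.2) 0) (xvL q.2) := by
  have he : Primrec fun q : (ℕ × (ℤ × List ℕ)) × ℕ => q.1.2.2 := Primrec.snd.comp (Primrec.snd.comp Primrec.fst)
  exact primrec_factorL.comp (Primrec.pair ((Primrec.list_getD 0).comp he Primrec.snd)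
    (Primrec.pair ((Primrec.list_getD 0).comp he (Primrec.nat_add.comp (Primrec.fst.comp Primrec.fst) Primrec.snd))
      (primrec_xvL.comp Primrec.snd)))

/-- `monoL n xvL m` on pairs `(n, m)` [folklore] -/
theorem primrec_monoL : Primrec fun p : ℕ × (ℤ × List ℕ) => monoL p.1 xvL p.2 := by
  unfold monoL
  exact primrec_mulL.comp (primrec_intL.comp (Primrec.fst.comp Primrec.snd))
    (primrec_prodL.comp (Primrec.list_map (Primrec.list_range.comp Primrec.fst) primrec_factorArgs.to₂))

set_option maxHeartbeats 1000000 in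
/-- `dmonoL n xvL (dxvL · kk) m` on triples `(n, m, kk)` (a long but routine composition; the
heartbeat budget is raised for its elaboration only) [folklore] -/
theorem primrec_dmonoL : Primrec fun p : ℕ × (ℤ × List ℕ) × ℕ => dmonoL p.1 xvL (fun i => dxvL i p.2.2) p.2.1 := by
  have hn : Primrec fun p : ℕ × (ℤ × List ℕ) × ℕ => p.1 := Primrec.fst
  have hm : Primrec fun p : ℕ × (ℤ × List ℕ) × ℕ => p.2.1 := Primrec.fst.comp Primrec.snd
  have hk : Primrec fun p : ℕ × (ℤ × List ℕ) × ℕ => p.2.2 := Primrec.snd.comp Primrec.snd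
  -- the factors and their derivatives, as functions of `(p, i)`
  have he : Primrec fun q : (ℕ × (ℤ × List ℕ) × ℕ) × ℕ => q.1.2.1.2 :=
    Primrec.snd.comp (Primrec.fst.comp (Primrec.snd.comp Primrec.fst))
  have ha : Primrec fun q : (ℕ × (ℤ × List ℕ) × ℕ) × ℕ => q.1.2.1.2.getD q.2 0 := (Primrec.list_getD 0).comp he Primrec.snd
  have hb : Primrec fun q : (ℕ × (ℤ × List ℕ) × ℕ) × ℕ => q.1.2.1.2.getD (q.1.1 + q.2) 0 :=
    (Primrec.list_getD 0).comp he (Primrec.nat_add.comp (Primrec.fst.comp Primrec.fst) Primrec.snd)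
  have hx : Primrec fun q : (ℕ × (ℤ × List ℕ) × ℕ) × ℕ => xvL q.2 := primrec_xvL.comp Primrec.snd
  have hdx : Primrec fun q : (ℕ × (ℤ × List ℕ) × ℕ) × ℕ => dxvL q.2 q.1.2.2 :=
    primrec_dxvL.comp Primrec.snd (Primrec.snd.comp (Primrec.snd.comp Primrec.fst))
  have hf : Primrec fun q : (ℕ × (ℤ × List ℕ) × ℕ) × ℕ =>
      factorL (q.1.2.1.2.getD q.2 0) (q.1.2.1.2.getD (q.1.1 + q.2) 0) (xvL q.2) :=
    primrec_factorL.comp (Primrec.pair ha (Primrec.pair hb hx))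
  have hdf : Primrec fun q : (ℕ × (ℤ × List ℕ) × ℕ) × ℕ =>
      dfactorL (q.1.2.1.2.getD q.2 0) (q.1.2.1.2.getD (q.1.1 + q.2) 0) (xvL q.2) (dxvL q.2 q.1.2.2) :=
    primrec_dfactorL.comp (Primrec.pair ha (Primrec.pair hb (Primrec.pair hx hdx)))
  have hmap1 : Primrec fun p : ℕ × (ℤ × List ℕ) × ℕ => (List.range p.1).map fun i =>
      factorL (p.2.1.2.getD i 0) (p.2.1.2.getD (p.1 + i) 0) (xvL i) :=
    Primrec.list_map (Primrec.list_range.comp hn) hf.to₂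
  have hmap2 : Primrec fun p : ℕ × (ℤ × List ℕ) × ℕ => (List.range p.1).map fun i =>
      (factorL (p.2.1.2.getD i 0) (p.2.1.2.getD (p.1 + i) 0) (xvL i),
        dfactorL (p.2.1.2.getD i 0) (p.2.1.2.getD (p.1 + i) 0) (xvL i) (dxvL i p.2.2)) :=
    Primrec.list_map (Primrec.list_range.comp hn) (Primrec.pair hf hdf).to₂
  have h : Primrec fun p : ℕ × (ℤ × List ℕ) × ℕ =>
      addL (mulL (dintL p.2.1.1) (prodL ((List.range p.1).map fun i =>
          factorL (p.2.1.2.getD i 0) (p.2.1.2.getD (p.1 + i) 0) (xvL i))))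
        (mulL (intL p.2.1.1) (dprodL ((List.range p.1).map fun i =>
          (factorL (p.2.1.2.getD i 0) (p.2.1.2.getD (p.1 + i) 0) (xvL i),
            dfactorL (p.2.1.2.getD i 0) (p.2.1.2.getD (p.1 + i) 0) (xvL i) (dxvL i p.2.2))))) :=
    primrec_addL.comp
      (primrec_mulL.comp (primrec_dintL.comp (Primrec.fst.comp hm)) (primrec_prodL.comp hmap1))
      (primrec_mulL.comp (primrec_intL.comp (Primrec.fst.comp hm)) (primrec_dprodL.comp hmap2))
  exact h.of_eq fun p => rfl

/-- `evalL` as a right fold (for the primitive recursion). [folklore] -/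
theorem evalL_eq_foldr (n : ℕ) (q : ExpPolyCode) :
    evalL n xvL q = q.foldr (fun m acc => addL (monoL n xvL m) acc) [lZero] := by
  induction q with
  | nil => rfl
  | cons m q ih => simp [evalL, ih]

/-- `evalL n xvL q` on pairs `(n, q)` [folklore] -/
theorem primrec_evalL : Primrec fun p : ℕ × ExpPolyCode => evalL p.1 xvL p.2 := by
  have hh : Primrec₂ fun (a : ℕ × ExpPolyCode) (q : (ℤ × List ℕ) × List ℕ) => addL (monoL a.1 xvL q.1) q.2 :=
    (primrec_addL.comp (primrec_monoL.comp (Primrec.pair (Primrec.fst.comp Primrec.fst)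
      (Primrec.fst.comp Primrec.snd))) (Primrec.snd.comp Primrec.snd)).to₂
  have h : Primrec fun p : ℕ × ExpPolyCode =>
      p.2.foldr (fun m acc => addL (monoL p.1 xvL m) acc) [lZero] :=
    Primrec.list_foldr (h := fun (a : ℕ × ExpPolyCode) (q : (ℤ × List ℕ) × List ℕ) =>
      addL (monoL a.1 xvL q.1) q.2) Primrec.snd (Primrec.const [lZero]) hh
  exact h.of_eq fun p => (evalL_eq_foldr p.1 p.2).symm

/-- `devalL` as a right fold (for the primitive recursion). [folklore] -/
theorem devalL_eq_foldr (n : ℕ) (q : ExpPolyCode) (kk : ℕ) :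
    devalL n xvL (fun i => dxvL i kk) q = q.foldr (fun m acc => addL (dmonoL n xvL (fun i => dxvL i kk) m) acc) [lZero] := by
  induction q with
  | nil => rfl
  | cons m q ih => simp [devalL, ih]

/-- `devalL n xvL (dxvL · kk) q` on triples `(n, q, kk)` [folklore] -/
theorem primrec_devalL : Primrec fun p : ℕ × ExpPolyCode × ℕ => devalL p.1 xvL (fun i => dxvL i p.2.2) p.2.1 := by
  have hh : Primrec₂ fun (a : ℕ × ExpPolyCode × ℕ) (q : (ℤ × List ℕ) × List ℕ) =>
      addL (dmonoL a.1 xvL (fun i => dxvL i a.2.2) q.1) q.2 :=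
    (primrec_addL.comp (primrec_dmonoL.comp (Primrec.pair (Primrec.fst.comp Primrec.fst)
      (Primrec.pair (Primrec.fst.comp Primrec.snd) (Primrec.snd.comp (Primrec.snd.comp Primrec.fst)))))
      (Primrec.snd.comp Primrec.snd)).to₂
  have h : Primrec fun p : ℕ × ExpPolyCode × ℕ =>
      p.2.1.foldr (fun m acc => addL (dmonoL p.1 xvL (fun i => dxvL i p.2.2) m) acc) [lZero] :=
    Primrec.list_foldr (h := fun (a : ℕ × ExpPolyCode × ℕ) (q : (ℤ × List ℕ) × List ℕ) =>
      addL (dmonoL a.1 xvL (fun i => dxvL i a.2.2) q.1) q.2) (Primrec.fst.comp Primrec.snd) (Primrec.const [lZero]) hh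
  exact h.of_eq fun p => (devalL_eq_foldr p.1 p.2.1 p.2.2).symm

/-! #### Formula letters -/

/-- `2 ⟪k, encode l⟫` on pairs `(k, l)` [folklore] -/
theorem primrec_termEntry : Primrec fun p : ℕ × List ℕ => 2 * Nat.pair p.1 (encode p.2) :=
  Primrec.nat_mul.comp (Primrec.const 2) (Primrec₂.natPair.comp Primrec.fst (Primrec.encode.comp Primrec.snd))

/-- `eqL` on triples `(k, l₁, l₂)` [folklore] -/
theorem primrec_eqL : Primrec fun p : ℕ × List ℕ × List ℕ => eqL p.1 p.2.1 p.2.2 := by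
  unfold eqL
  exact Primrec.list_cons.comp (primrec_termEntry.comp (Primrec.pair Primrec.fst (Primrec.fst.comp Primrec.snd)))
    (Primrec.list_cons.comp (primrec_termEntry.comp (Primrec.pair Primrec.fst (Primrec.snd.comp Primrec.snd)))
      (Primrec.const []))

/-- `leL` on triples `(k, l₁, l₂)` [folklore] -/
theorem primrec_leL : Primrec fun p : ℕ × List ℕ × List ℕ => leL p.1 p.2.1 p.2.2 := by
  unfold leL
  refine Primrec.list_cons.comp (Primrec.const _) (Primrec.list_cons.comp
    (Primrec.nat_add.comp (Primrec.nat_mul.comp (Primrec.const 4) Primrec.fst) (Primrec.const 3)) ?_)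
  exact Primrec.list_cons.comp (primrec_termEntry.comp (Primrec.pair Primrec.fst (Primrec.fst.comp Primrec.snd)))
    (Primrec.list_cons.comp (primrec_termEntry.comp (Primrec.pair Primrec.fst (Primrec.snd.comp Primrec.snd)))
      (Primrec.const []))

/-- `falsumL` is primitive recursive (in the indicated tupling of its arguments). [folklore] -/
theorem primrec_falsumL : Primrec falsumL :=
  Primrec.list_cons.comp (Primrec.nat_add.comp (Primrec.nat_mul.comp (Primrec.const 4) Primrec.id)
    (Primrec.const 11)) (Primrec.const [])

/-- `impL` is primitive recursive (in the indicated tupling of its arguments). [folklore] -/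
theorem primrec_impL : Primrec₂ impL :=
  (Primrec.list_cons.comp (Primrec.const 3) (Primrec.list_append.comp Primrec.fst Primrec.snd)).to₂

/-- `notL` is primitive recursive (in the indicated tupling of its arguments). [folklore] -/
theorem primrec_notL : Primrec₂ notL :=
  (primrec_impL.comp Primrec.snd (primrec_falsumL.comp Primrec.fst)).to₂

/-- `topL` is primitive recursive (in the indicated tupling of its arguments). [folklore] -/
theorem primrec_topL : Primrec topL :=
  primrec_notL.comp Primrec.id primrec_falsumL

/-- `infL` on triples `(k, l₁, l₂)` [folklore] -/
theorem primrec_infL : Primrec fun p : ℕ × List ℕ × List ℕ => infL p.1 p.2.1 p.2.2 := by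
  unfold infL
  exact primrec_notL.comp Primrec.fst (primrec_impL.comp (Primrec.fst.comp Primrec.snd)
    (primrec_notL.comp Primrec.fst (Primrec.snd.comp Primrec.snd)))

/-- `andLL` as a right fold (for the primitive recursion). [folklore] -/
theorem andLL_eq_foldr (k : ℕ) (ls : List (List ℕ)) : andLL k ls = ls.foldr (infL k) (topL k) := by
  induction ls with
  | nil => rfl
  | cons l ls ih => simp [andLL, ih]

/-- `andLL` is primitive recursive (in the indicated tupling of its arguments). [folklore] -/
theorem primrec_andLL : Primrec₂ andLL := by
  have h : Primrec fun p : ℕ × List (List ℕ) => p.2.foldr (infL p.1) (topL p.1) :=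
    Primrec.list_foldr Primrec.snd (primrec_topL.comp Primrec.fst)
      (primrec_infL.comp (Primrec.pair (Primrec.fst.comp Primrec.fst)
        (Primrec.pair (Primrec.fst.comp Primrec.snd) (Primrec.snd.comp Primrec.snd)))).to₂
  exact (h.of_eq fun p => (andLL_eq_foldr p.1 p.2).symm).to₂

/-! #### Letters of `σ` -/

/-- the depth `n + n·n` [folklore] -/
theorem primrec_depth : Primrec fun n : ℕ => n + n * n :=
  Primrec.nat_add.comp Primrec.id (Primrec.nat_mul.comp Primrec.id Primrec.id)

/-- `zeroBL` on pairs `(n, F)` [folklore] -/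
theorem primrec_zeroBL : Primrec fun p : ℕ × List ExpPolyCode => zeroBL p.1 p.2 := by
  unfold zeroBL
  refine primrec_andLL.comp (primrec_depth.comp Primrec.fst) ?_
  refine Primrec.list_map (Primrec.list_range.comp Primrec.fst) ?_
  have hg : Primrec fun q : (ℕ × List ExpPolyCode) × ℕ =>
      eqL (q.1.1 + q.1.1 * q.1.1) (evalL q.1.1 xvL (q.1.2.getD q.2 [])) [lZero] :=
    primrec_eqL.comp (Primrec.pair (primrec_depth.comp (Primrec.fst.comp Primrec.fst))
      (Primrec.pair (primrec_evalL.comp (Primrec.pair (Primrec.fst.comp Primrec.fst)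
        ((Primrec.list_getD []).comp (Primrec.snd.comp Primrec.fst) Primrec.snd)))
        (Primrec.const _)))
  exact hg.to₂

/-- `invEntryL` on quadruples `(n, F, i, kk)` [folklore] -/
theorem primrec_invEntryL :
    Primrec fun p : ℕ × List ExpPolyCode × ℕ × ℕ => invEntryL p.1 p.2.1 p.2.2.1 p.2.2.2 := by
  unfold invEntryL
  have hn : Primrec fun p : ℕ × List ExpPolyCode × ℕ × ℕ => p.1 := Primrec.fst
  have hF : Primrec fun p : ℕ × List ExpPolyCode × ℕ × ℕ => p.2.1 := Primrec.fst.comp Primrec.snd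
  have hi : Primrec fun p : ℕ × List ExpPolyCode × ℕ × ℕ => p.2.2.1 :=
    Primrec.fst.comp (Primrec.snd.comp Primrec.snd)
  have hk : Primrec fun p : ℕ × List ExpPolyCode × ℕ × ℕ => p.2.2.2 :=
    Primrec.snd.comp (Primrec.snd.comp Primrec.snd)
  refine primrec_eqL.comp (Primrec.pair (primrec_depth.comp hn) (Primrec.pair ?_ ?_))
  · refine primrec_sumL.comp (Primrec.list_map (Primrec.list_range.comp hn) ?_)
    have hg : Primrec fun q : (ℕ × List ExpPolyCode × ℕ × ℕ) × ℕ =>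
        mulL (bvL q.1.1 q.1.2.2.1 q.2) (devalL q.1.1 xvL (fun i' => dxvL i' q.1.2.2.2) (q.1.2.1.getD q.2 [])) :=
      primrec_mulL.comp
        (primrec_bvL.comp (Primrec.pair (hn.comp Primrec.fst) (Primrec.pair (hi.comp Primrec.fst) Primrec.snd)))
        (primrec_devalL.comp (Primrec.pair (hn.comp Primrec.fst) (Primrec.pair
          ((Primrec.list_getD []).comp (hF.comp Primrec.fst) Primrec.snd) (hk.comp Primrec.fst))))
    exact hg.to₂
  · exact Primrec.ite (PrimrecRel.comp Primrec.eq hi hk) (Primrec.const _) (Primrec.const _)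

/-- `invBL` on pairs `(n, F)` [folklore] -/
theorem primrec_invBL : Primrec fun p : ℕ × List ExpPolyCode => invBL p.1 p.2 := by
  unfold invBL
  refine primrec_andLL.comp (primrec_depth.comp Primrec.fst) ?_
  refine Primrec.list_map (Primrec.list_range.comp Primrec.fst) ?_
  have hg : Primrec fun q : (ℕ × List ExpPolyCode) × ℕ =>
      andLL (q.1.1 + q.1.1 * q.1.1) ((List.range q.1.1).map fun kk => invEntryL q.1.1 q.1.2 q.2 kk) := by
    refine primrec_andLL.comp (primrec_depth.comp (Primrec.fst.comp Primrec.fst)) ?_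
    refine Primrec.list_map (Primrec.list_range.comp (Primrec.fst.comp Primrec.fst)) ?_
    have hh : Primrec fun r : ((ℕ × List ExpPolyCode) × ℕ) × ℕ =>
        invEntryL r.1.1.1 r.1.1.2 r.1.2 r.2 :=
      primrec_invEntryL.comp (Primrec.pair (Primrec.fst.comp (Primrec.fst.comp Primrec.fst))
        (Primrec.pair (Primrec.snd.comp (Primrec.fst.comp Primrec.fst))
          (Primrec.pair (Primrec.snd.comp Primrec.fst) Primrec.snd)))
    exact hh.to₂
  exact hg.to₂

/-- `boundBL` on pairs `(n, η)` [folklore] -/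
theorem primrec_boundBL : Primrec fun p : ℕ × ℕ => boundBL p.1 p.2 := by
  unfold boundBL
  refine primrec_andLL.comp (primrec_depth.comp Primrec.fst) ?_
  refine Primrec.list_map (Primrec.list_range.comp Primrec.fst) ?_
  have hK : Primrec fun q : (ℕ × ℕ) × ℕ => q.1.1 + q.1.1 * q.1.1 := primrec_depth.comp (Primrec.fst.comp Primrec.fst)
  have hη : Primrec fun q : (ℕ × ℕ) × ℕ => natL q.1.2 := primrec_natL.comp (Primrec.snd.comp Primrec.fst)
  have hx : Primrec fun q : (ℕ × ℕ) × ℕ => xvL q.2 := primrec_xvL.comp Primrec.snd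
  have hg : Primrec fun q : (ℕ × ℕ) × ℕ =>
      infL (q.1.1 + q.1.1 * q.1.1) (leL (q.1.1 + q.1.1 * q.1.1) (lNeg :: natL q.1.2) (xvL q.2))
        (leL (q.1.1 + q.1.1 * q.1.1) (xvL q.2) (natL q.1.2)) :=
    primrec_infL.comp (Primrec.pair hK (Primrec.pair
      (primrec_leL.comp (Primrec.pair hK (Primrec.pair (Primrec.list_cons.comp (Primrec.const _) hη) hx)))
      (primrec_leL.comp (Primrec.pair hK (Primrec.pair hx hη)))))
  exact hg.to₂

/-- `chiL` on triples `(n, F, η)` [folklore] -/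
theorem primrec_chiL : Primrec fun p : ℕ × List ExpPolyCode × ℕ => chiL p.1 p.2.1 p.2.2 := by
  unfold chiL
  exact primrec_impL.comp (primrec_infL.comp (Primrec.pair (primrec_depth.comp Primrec.fst)
    (Primrec.pair (primrec_zeroBL.comp (Primrec.pair Primrec.fst (Primrec.fst.comp Primrec.snd)))
      (primrec_invBL.comp (Primrec.pair Primrec.fst (Primrec.fst.comp Primrec.snd))))))
    (primrec_boundBL.comp (Primrec.pair Primrec.fst (Primrec.snd.comp Primrec.snd)))

/-- `replicate` as an iteration (for the primitive recursion). [folklore] -/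
theorem replicate_eq_iterate (k a : ℕ) : List.replicate k a = (fun l => a :: l)^[k] [] := by
  induction k with
  | zero => rfl
  | succ k ih => rw [Function.iterate_succ_apply', ← ih, List.replicate_succ]

/-- **the letters of `σ_{F,η}` are a primitive recursive function of `(n, F, η)`** [folklore] -/
theorem primrec_sigmaL : Primrec fun p : ℕ × List ExpPolyCode × ℕ => sigmaL p.1 p.2.1 p.2.2 := by
  unfold sigmaL
  refine Primrec.list_append.comp ?_ primrec_chiL
  have h : Primrec fun p : ℕ × List ExpPolyCode × ℕ => (fun l => 7 :: l)^[p.1 + p.1 * p.1] ([] : List ℕ) :=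
    Primrec.nat_iterate (primrec_depth.comp Primrec.fst) (Primrec.const [])
      (Primrec.list_cons.comp (Primrec.const 7) Primrec.snd).to₂
  exact h.of_eq fun p => (replicate_eq_iterate _ 7).symm

/-- hence **the Gödel number of `σ_{F,η}` is a computable function of `(n, F, η)`** [folklore] -/
theorem computable_godelNumber_sigma :
    Computable fun p : ℕ × List ExpPolyCode × ℕ => (sigma p.1 p.2.1 p.2.2).godelNumber :=
  ((Primrec.encode.comp primrec_sigmaL).to_comp).of_eq fun p => (godelNumber_sigma p.1 p.2.1 p.2.2).symm

end PrimrecLetters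

/-! ### The easy half of Macintyre–Wilkie's equivalence: decidability gives the Last Root bound -/

section OfDecidable

open FirstOrder FirstOrder.Language Encodable

/-- truth in `ℝ_exp` of a sentence is consequence from `Th(ℝ_exp)` [folklore] -/
theorem realExpTheory_models_iff (φ : Language.orderedExpRing.Sentence) :
    realExpTheory ⊨ᵇ φ ↔ ℝ ⊨ φ := by
  unfold realExpTheory
  rw [← (completeTheory.isMaximal Language.orderedExpRing ℝ).mem_iff_models, mem_completeTheory]

/-- a computable total search: if a computable test succeeds somewhere for every input, the least
success point is a computable function of the input [folklore] -/
theorem exists_computable_search {α : Type*} [Primcodable α] {t : α → ℕ → Bool} (ht : Computable₂ t)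
    (hex : ∀ a, ∃ n, t a n = true) : ∃ f : α → ℕ, Computable f ∧ ∀ a, t a (f a) = true := by
  have hfind : Partrec fun a => Nat.rfind fun n => Part.some (t a n) := Partrec.rfind ht.partrec₂
  have hdom : ∀ a, (Nat.rfind fun n => Part.some (t a n)).Dom := fun a => by
    obtain ⟨n, hn⟩ := hex a
    exact Nat.rfind_dom.2 ⟨n, by simp [hn], fun _ => trivial⟩
  refine ⟨fun a => (Nat.rfind fun n => Part.some (t a n)).get (hdom a), ?_, fun a => ?_⟩
  · exact hfind.of_eq fun a => Part.eq_some_iff.2 (Part.get_mem (hdom a))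
  · have h := Nat.rfind_spec (Part.get_mem (hdom a))
    simpa using h

/-- a decision procedure for `Th(ℝ_exp)` decides truth in `ℝ_exp` of any given sentence [folklore] -/
theorem exists_truth_decider (hD : realExpTheory.IsDecidable) :
    ∃ d : ℕ → Bool, Computable d ∧ ∀ φ : Language.orderedExpRing.Sentence, d φ.godelNumber = true ↔ ℝ ⊨ φ := by
  obtain ⟨d, hd, hdp⟩ := ComputablePred.computable_iff.1 hD
  refine ⟨d, hd, fun φ => ?_⟩
  have h := congrFun hdp φ.godelNumber
  simp only [eq_iff_iff] at h
  rw [← h, ← realExpTheory_models_iff]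
  constructor
  · rintro ⟨ψ, hψ, he⟩
    rwa [Sentence.godelNumber_injective he] at hψ
  · exact fun hφ => ⟨φ, hφ, rfl⟩

/-- **Decidability of `Th(ℝ_exp)` and o-minimality of `ℝ_exp` give a computable bound on the
non-singular zeros of every `n × n` system** (the direction `→` of Macintyre–Wilkie's equivalence
between decidability and the Last Root Conjecture): search, with the decision procedure, for the
least `η` such that the sentence `σ_{F,η}` is true. [folklore] -/
theorem exists_computable_bound_of_isDecidable (hO : Language.orderedExpRing.IsOMinimal ℝ)
    (hD : realExpTheory.IsDecidable) :
    ∃ η : ℕ × List ExpPolyCode → ℕ, Computable η ∧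
      ∀ (n : ℕ) (F : List ExpPolyCode) (a : Fin n → ℝ), IsNonsingularZero n F a → ‖a‖ < η (n, F) := by
  obtain ⟨d, hd, hd_iff⟩ := exists_truth_decider hD
  have hL : Primrec fun q : (ℕ × List ExpPolyCode) × ℕ => sigmaL q.1.1 q.1.2 q.2 :=
    primrec_sigmaL.comp (Primrec.pair (Primrec.fst.comp Primrec.fst)
      (Primrec.pair (Primrec.snd.comp Primrec.fst) Primrec.snd))
  have htest : Computable₂ fun (p : ℕ × List ExpPolyCode) (η : ℕ) => d (encode (sigmaL p.1 p.2 η)) :=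
    hd.comp (Primrec.encode.comp hL).to_comp
  have htest_iff : ∀ (p : ℕ × List ExpPolyCode) (η : ℕ),
      d (encode (sigmaL p.1 p.2 η)) = true ↔ ℝ ⊨ sigma p.1 p.2 η := fun p η => by
    rw [← godelNumber_sigma]; exact hd_iff _
  obtain ⟨f, hf, hf_spec⟩ := exists_computable_search htest fun p =>
    (exists_realize_sigma hO p.1 p.2).imp fun η hη => (htest_iff p η).2 hη
  refine ⟨fun p => f p + 1, Computable.succ.comp hf, fun n F a ha => ?_⟩
  have h := norm_lt_of_realize_sigma ((htest_iff (n, F) _).1 (hf_spec (n, F))) ha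
  push_cast
  exact h

end OfDecidable

end ExpPolyCode

/-! ### The easy half of the equivalence, and Schanuel ⇒ Last Root -/

/-- **Macintyre–Wilkie's equivalence, direction `→`, proved from Wilkie's theorem**: if `ℝ_exp` is
o-minimal (`Literature.ModelTheory.ExponentialFields.wilkie_isOMinimal`) and `Th(ℝ_exp)` is decidable, then the Last Root Conjecture
holds — a computable bound on the non-singular zeros of `n × n` exponential systems is obtained by
searching, with the decision procedure, for a true bounding sentence `σ_{F,η}`
(Berarducci–Servi 2004, p. 44, reporting Macintyre–Wilkie 1996). [cite: BerarducciServi2004, p. 44] -/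
theorem lastRootConjecture_of_realExpDecidable (hO : wilkie_isOMinimal) (hD : RealExpDecidable) :
    LastRootConjecture :=
  ExpPolyCode.exists_computable_bound_of_isDecidable hO hD

/-- Hence, granted Wilkie's o-minimality theorem, Macintyre–Wilkie's Thm. 1.1
(`Literature.ModelTheory.ExponentialFields.macintyre_wilkie`) makes the real Schanuel property imply the Last Root Conjecture — the
statement `Literature.ModelTheory.ExponentialFields.lastRootConjecture_of_schanuelProperty` of `LastRootConjecture.lean`, no longer
depending on the named equivalence. [cite: MacintyreWilkieKreiseliana1996, Thm. 1.1] -/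
theorem lastRootConjecture_of_schanuelProperty_of_wilkie_isOMinimal (hO : wilkie_isOMinimal)
    (hMW : macintyre_wilkie) (hS : SchanuelProperty ℝ) : LastRootConjecture :=
  lastRootConjecture_of_realExpDecidable hO (hMW hS)

end Literature.ModelTheory.ExponentialFields

end
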